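import Summits.QuantumFields.BalabanUV.T4Continuum.Spine.NE1p.DressedRoot

/-!
# Spine/NE1p/LeafIndex — the TYPER's leaf index of row NE1′ (node O3b∕H2, DRESSED STABILITY, μ-∕K-uniform):
# the booking-level leaf ids of `HOME/t4/formal/NE1p/DAG.md` §2 as TRANSPARENT ABBREVIATIONS of the field types of
# `DressedRoot.BookingLeaves`, and the bookkeeping faces «one `UniformConstants` + per-cutoff leaves ⟹ `DressedStability`»
# and «END-F's binders, named by leaf id ⟹ the transport leaf» BY NAME

Cell `pub-balaban`, T⁴-continuum fan-out, spine row NE1′ (RULING R-t4r2-Q2), formalisation swarm `t4-ne1p-formalise-*`, unit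
`b2b-balaban-t4-ne1p-formalise-typer` (gen 1).  Skeleton of record `HOME/t4/skeletons/NE1p-t4-ne1p-p1.md` v1.1 (owner
t4-ne1p-p1-g23; v1 sha16 443cf3173219a3e2, acknowledged by t4-ref2 pass 63, trigger `t4/T4-NE1p-TRIGGER.json` + scope_update_64).
Root of record: `DressedRoot.DressedStability` (p211416).

WHAT THIS FILE IS.  Vocabulary + a kernel re-check, NOTHING ELSE: (i) the STRUCTURAL ∕ ARITHMETIC ∕ GEOMETRIC booking-level
leaves L-T (transport), L-B (births), L-F (family factor), L-C (live-family count) are `abbrev`s whose bodies are the field types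
of `BookingLeaves` VERBATIM — they unfold by `rfl`, no content is restated; (ii) the WALL leaves L-R ((w5) regeneration constant)
and L-A ((w2-act) THE NUMBER `s₀ ≤ s̄⁰`) and the function-level walls F-1 ∕ F-3 ∕ F-6 get NO abbreviation and NO `def … : Prop`
(trigger c3): they appear below only as DISPLAYED BINDERS of the faces, with their types verbatim; (iii) the faces
`bookingLeavesOfLeaves` (the constructor, binders named by leaf id), `classAt_of_leaves` (= `DressedRoot.classAt_of_bookingLeaves`),
`dressedStability_of_leaves` (= END-B `DressedRoot.dressedStability_of_bookingLeaves` with ONE `U : UniformConstants` for ALL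
sources `p` and cutoffs `K` — the quantifier order that IS the content of NE1′, referee caveat k1 — and the per-`(p, K)` leaves
displayed), `transport_of_Fleaves` (= END-F `DressedRoot.transportLeaf_of_centredExponent` with its binders NAMED BY THE F-ids
F-1…F-9 of the DAG) and the seam `leafT_of_transport` (END-F's constants `4c_δ∕r`, `ψ·α` ARE the bundle's `U.C`, `ρ` once the
S3 cell fixes them) restate the END theorems with the binders named by leaf id, so that the referee's check «the binder list maps
one-to-one onto the leaf table, no binder unaccounted» is a kernel fact: each proof is the END theorem applied to the binders in
order, and nothing else.

WHAT THIS FILE IS NOT.  Not an instance and not an estimate: the swarm's rows S1–S8 ∕ W1 (`HOME/t4/formal/NE1p/LEAVES.md`)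
land the suppliers (`DressedWindowSchedule` p212498, `DressedTransportAssembled` p212485, `DressedBirthSuppliers` p212423, …);
a row counts landed only when a tree lemma's CONCLUSION is verbatim a field type of `BookingLeaves` or a binder of END-F (c4) —
these ids and the tree names are the same terms.

HONEST FRAMING.  NE1′ («the small-field effective densities stay in ONE analyticity class with K-independent constants») is
printed NOWHERE as a theorem and is NOT PROVED here or anywhere in the tree: END-B consumes the booked `BookingLeaves` bundle;
the walls (w1) F-1, (w2-act) L-A∕F-3, (w5) L-R, (I4′) F-6's rate ψ = L⁻² stay DISPLAYED BINDERS, asserted for Bałaban's densities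
by nobody; the printed loci ([Balaban1989LargeFieldII] (1.65)∕(1.71)–(1.75) pp. 375–380, p. 388, p. 391; B15 Prop. 1; B7 (44)–(47);
B12 (3.31)–(3.32), (3.37)) are TYPES∕CONTEXT only (c3) — 0 cite tags below.  Headline: «NE1′ ⇐ the named binders», never
«NE1′ proved» (c4).  `FlowStep.BetaPertH` ∕ (B) ∕ (B^μ) ∕ G-an2-4 occur nowhere in this module (c6).  Finite T⁴ bookkeeping — NOT
infinite volume, NOT a mass gap, NOT the Clay problem.  Spine PROVED 0∕9.  HONEST DEPENDENCY: continuum YM on T⁴ ⇐ BetaPertH ∧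
nine spine estimates (0/9 proved); BetaPertH ⇐ (D1) ∧ (D4) ∧ CAP+tail; G-an2-4 gates asym, D1 and NE2/3/4.  0 sorry; axioms
standard; imports `Spine/NE1p/DressedRoot` only.
-/

noncomputable section

namespace Summit.QuantumFields.BalabanUV.T4Continuum.NE1p.LeafIndex

open Finset
open scoped BigOperators
open Literature.MathematicalPhysics.QuantumFieldTheory.Balaban1983to89
open Literature.MathematicalPhysics.QuantumFieldTheory.Balaban1983to89.T4TermFormat
open Literature.MathematicalPhysics.QuantumFieldTheory.Balaban1983to89.T4TermFormat.Booking
open Literature.MathematicalPhysics.QuantumFieldTheory.Balaban1983to89.T4GatedBooking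
open Literature.MathematicalPhysics.QuantumFieldTheory.Balaban1983to89.T4TrajectoryComparison
open Summit.QuantumFields.BalabanUV.T4Continuum.T4TrajectoryDensityDressed
open Summit.QuantumFields.BalabanUV.T4Continuum.NE1p.DressedRoot

/-! ## §1 The booking-level leaf ids (DAG.md §2) as transparent abbreviations of the `BookingLeaves` field types -/

section LeafIds

/-- **L-T** (transport leaf, T): gated variable-rate transport under the DRESSED gate — the type of `BookingLeaves.htr` BY NAME.
Supplied by END-F `DressedRoot.transportLeaf_of_centredExponent` ∕ END-F′ `DressedTransportAssembled.transportLeaf_assembled`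
(row S2) with `U.C = 4c_δ∕r`, `ρ i = ψ·α i` (seam `leafT_of_transport`). [folklore] -/
abbrev LeafT (U : UniformConstants) {Bk : T4TermFormat.Booking} (T : Trajectory Bk) (ρ : ℕ → ℝ)
    (s₀ : Bk.Birth → ℕ → ℝ) (S : ℕ → Bk.Birth → Finset Bk.Birth) : Prop :=
  T.TransportsFromVar U.C ρ (budgetGate T s₀ U.m S U.C ρ)

/-- **L-B** (birth leaf, (w1)+(w5b) DATA slots): history-sourced births in the uniform two-rate class under the dressed gate —
the type of `BookingLeaves.hbirth` BY NAME.  Supplied by row S5 `DressedBirthSuppliers.hbirth_of_birthGen` ∕ `hbirth_of_absorbsFrom`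
∕ `hbirth_of_absorbsFrom_live` ∕ `hbirth_of_rstep` (p212423); the (w1) amplitude and the (w5b) smallness stay their binders. [folklore] -/
abbrev LeafB (U : UniformConstants) {Bk : T4TermFormat.Booking} (T : Trajectory Bk) (ρ : ℕ → ℝ)
    (s₀ : Bk.Birth → ℕ → ℝ) (S : ℕ → Bk.Birth → Finset Bk.Birth) : Prop :=
  T.BirthsFromOld U.C ρ (twoRate U.A₀ U.ρ₁ U.τ Bk.K) (budgetGate T s₀ U.m S U.C ρ)

/-- **L-F** ((w7) family factor, ARITHMETIC): the per-step transport rate plus `C`× the regeneration constant is below the uniform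
`ρ₁` — the type of `BookingLeaves.hrate` BY NAME.  Supplied by row S3 `DressedUniformConstants` (K-∕μ-FREE, k1∕k2). [folklore] -/
abbrev LeafF (U : UniformConstants) (Bk : T4TermFormat.Booking) (ρ c : ℕ → ℝ) : Prop :=
  ∀ k, k < Bk.K → ρ k + U.C * c k ≤ U.ρ₁

/-- **L-C** ((w3-book) live-family count, GEOMETRY∕bookkeeping): live families are born, and their positional count per birth
scale is `N₀Λ^{k−j}` — the types of `BookingLeaves.hS` ∧ `BookingLeaves.hcount` BY NAME.  Supplied by row S4
`DressedPositionalCount` (`T4FeltGeometry.positionalCount_of_anchoring` instance). [folklore] -/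
abbrev LeafC (U : UniformConstants) (Bk : T4TermFormat.Booking) (S : ℕ → Bk.Birth → Finset Bk.Birth) : Prop :=
  (∀ k b, ∀ f ∈ S k b, Bk.birthScale f ≤ k) ∧
    ∀ k b, ∀ j ≤ k, (((S k b).filter fun f => Bk.birthScale f = j).card : ℝ) ≤ U.N₀ * U.Λ ^ (k - j)

variable (U : UniformConstants) {Bk : T4TermFormat.Booking} (T : Trajectory Bk) (ρ c : ℕ → ℝ)
  (s₀ : Bk.Birth → ℕ → ℝ) (S : ℕ → Bk.Birth → Finset Bk.Birth)

/-- L-T's id unfolds to the field type of `BookingLeaves.htr` (transparent abbrev). [folklore] -/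
theorem leafT_iff : LeafT U T ρ s₀ S ↔ T.TransportsFromVar U.C ρ (budgetGate T s₀ U.m S U.C ρ) := Iff.rfl

/-- L-B's id unfolds to the field type of `BookingLeaves.hbirth` (transparent abbrev). [folklore] -/
theorem leafB_iff :
    LeafB U T ρ s₀ S ↔ T.BirthsFromOld U.C ρ (twoRate U.A₀ U.ρ₁ U.τ Bk.K) (budgetGate T s₀ U.m S U.C ρ) := Iff.rfl

/-- L-F's id unfolds to the field type of `BookingLeaves.hrate` (transparent abbrev). [folklore] -/
theorem leafF_iff : LeafF U Bk ρ c ↔ ∀ k, k < Bk.K → ρ k + U.C * c k ≤ U.ρ₁ := Iff.rfl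

/-- L-C's id unfolds to the field types of `BookingLeaves.hS` ∧ `BookingLeaves.hcount` (transparent abbrev). [folklore] -/
theorem leafC_iff : LeafC U Bk S ↔ (∀ k b, ∀ f ∈ S k b, Bk.birthScale f ≤ k) ∧
    ∀ k b, ∀ j ≤ k, (((S k b).filter fun f => Bk.birthScale f = j).card : ℝ) ≤ U.N₀ * U.Λ ^ (k - j) := Iff.rfl

/-- The leaves OF a booked bundle, read back by name (the ids and the fields are the same terms). [folklore] -/
theorem leaves_of_bookingLeaves (L : BookingLeaves U Bk T) :
    LeafT U T L.ρ L.s₀ L.S ∧ LeafB U T L.ρ L.s₀ L.S ∧ LeafF U Bk L.ρ L.c ∧ LeafC U Bk L.S ∧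
      (∀ b k, L.s₀ b k ≤ U.sbar) ∧ T.RegeneratesFromVar L.c (budgetGate T L.s₀ U.m L.S U.C L.ρ) :=
  ⟨L.htr, L.hbirth, L.hrate, ⟨L.hS, L.hcount⟩, L.hs₀, L.hreg⟩

end LeafIds

/-! ## §2 The booking-level faces: one `UniformConstants` + per-cutoff leaves ⟹ the root, BY NAME -/

section Faces

variable (U : UniformConstants) {Bk : T4TermFormat.Booking} (T : Trajectory Bk)

/-- **THE BUNDLE FROM ITS LEAVES** (constructor face; binders named by leaf id, the two walls DISPLAYED): transport L-T, births
L-B, family factor L-F, live-family count L-C — and, displayed verbatim with NO id of their own (c3), the (w2-act) action-margin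
wall `hLA : ∀ b k, s₀ b k ≤ U.sbar` (THE NUMBER) and the (w5) regeneration wall `hLR : T.RegeneratesFromVar c (budgetGate …)`.
[folklore] -/
def bookingLeavesOfLeaves (ρ c : ℕ → ℝ) (s₀ : Bk.Birth → ℕ → ℝ) (S : ℕ → Bk.Birth → Finset Bk.Birth)
    (hρ : ∀ k, 0 ≤ ρ k) (hc : ∀ k, 0 ≤ c k) (hLF : LeafF U Bk ρ c) (hLC : LeafC U Bk S)
    (hLA : ∀ b k, s₀ b k ≤ U.sbar) (hLB : LeafB U T ρ s₀ S) (hLT : LeafT U T ρ s₀ S)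
    (hLR : T.RegeneratesFromVar c (budgetGate T s₀ U.m S U.C ρ)) : BookingLeaves U Bk T where
  ρ := ρ
  c := c
  s₀ := s₀
  S := S
  hρ := hρ
  hc := hc
  hrate := hLF
  hS := hLC.1
  hcount := hLC.2
  hs₀ := hLA
  hbirth := hLB
  htr := hLT
  hreg := hLR

/-- **PER-CUTOFF FACE** (= `DressedRoot.classAt_of_bookingLeaves` BY NAME): the leaves of one cutoff put its bookings in the
class `ClassAt Bk U.A₀ U.ρ₁ U.τ` AND keep the dressed gate open at every scale. [folklore] -/
theorem classAt_of_leaves (ρ c : ℕ → ℝ) (s₀ : Bk.Birth → ℕ → ℝ) (S : ℕ → Bk.Birth → Finset Bk.Birth)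
    (hρ : ∀ k, 0 ≤ ρ k) (hc : ∀ k, 0 ≤ c k) (hLF : LeafF U Bk ρ c) (hLC : LeafC U Bk S)
    (hLA : ∀ b k, s₀ b k ≤ U.sbar) (hLB : LeafB U T ρ s₀ S) (hLT : LeafT U T ρ s₀ S)
    (hLR : T.RegeneratesFromVar c (budgetGate T s₀ U.m S U.C ρ)) :
    ClassAt Bk U.A₀ U.ρ₁ U.τ ∧ ∀ k, k ≤ Bk.K → RanBelow (budgetGate T s₀ U.m S U.C ρ) k :=
  classAt_of_bookingLeaves (bookingLeavesOfLeaves U T ρ c s₀ S hρ hc hLF hLC hLA hLB hLT hLR)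

/-- **END-B BY LEAF ID — «NE1′ ⇐ the named binders»** (= `DressedRoot.dressedStability_of_bookingLeaves` BY NAME): ONE
`U : UniformConstants` (K- and μ-FREE: it does not depend on the source `p` or the cutoff `K` — the quantifier order that IS the
content of the dressed-stability node, referee caveat k1) and, for EVERY `(p, K)`, the leaves L-T ∕ L-B ∕ L-F ∕ L-C of that cutoff's
bookings plus the two displayed walls ⟹ `DressedStability 𝒯`.  Nothing of Bałaban's densities is asserted; NE1′ is NOT proved by
this face — it is the face. [folklore] -/
theorem dressedStability_of_leaves {P : Type*} (𝒯 : DressedTower P) (ρ c : P → ℕ → ℕ → ℝ)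
    (s₀ : ∀ p K, (𝒯.B p K).Birth → ℕ → ℝ) (S : ∀ p K, ℕ → (𝒯.B p K).Birth → Finset (𝒯.B p K).Birth)
    (hρ : ∀ p K k, 0 ≤ ρ p K k) (hc : ∀ p K k, 0 ≤ c p K k) (hLF : ∀ p K, LeafF U (𝒯.B p K) (ρ p K) (c p K))
    (hLC : ∀ p K, LeafC U (𝒯.B p K) (S p K)) (hLA : ∀ p K b k, s₀ p K b k ≤ U.sbar)
    (hLB : ∀ p K, LeafB U (𝒯.T p K) (ρ p K) (s₀ p K) (S p K))
    (hLT : ∀ p K, LeafT U (𝒯.T p K) (ρ p K) (s₀ p K) (S p K))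
    (hLR : ∀ p K, (𝒯.T p K).RegeneratesFromVar (c p K) (budgetGate (𝒯.T p K) (s₀ p K) U.m (S p K) U.C (ρ p K))) :
    DressedStability 𝒯 :=
  dressedStability_of_bookingLeaves U 𝒯 fun p K =>
    bookingLeavesOfLeaves U (𝒯.T p K) (ρ p K) (c p K) (s₀ p K) (S p K) (hρ p K) (hc p K) (hLF p K) (hLC p K) (hLA p K)
      (hLB p K) (hLT p K) (hLR p K)

/-- The same face with the constants displayed: `DressedStabilityWith 𝒯 U.A₀ U.ρ₁ U.τ`. [folklore] -/
theorem dressedStabilityWith_of_leaves {P : Type*} (𝒯 : DressedTower P) (ρ c : P → ℕ → ℕ → ℝ)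
    (s₀ : ∀ p K, (𝒯.B p K).Birth → ℕ → ℝ) (S : ∀ p K, ℕ → (𝒯.B p K).Birth → Finset (𝒯.B p K).Birth)
    (hρ : ∀ p K k, 0 ≤ ρ p K k) (hc : ∀ p K k, 0 ≤ c p K k) (hLF : ∀ p K, LeafF U (𝒯.B p K) (ρ p K) (c p K))
    (hLC : ∀ p K, LeafC U (𝒯.B p K) (S p K)) (hLA : ∀ p K b k, s₀ p K b k ≤ U.sbar)
    (hLB : ∀ p K, LeafB U (𝒯.T p K) (ρ p K) (s₀ p K) (S p K))
    (hLT : ∀ p K, LeafT U (𝒯.T p K) (ρ p K) (s₀ p K) (S p K))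
    (hLR : ∀ p K, (𝒯.T p K).RegeneratesFromVar (c p K) (budgetGate (𝒯.T p K) (s₀ p K) U.m (S p K) U.C (ρ p K))) :
    DressedStabilityWith 𝒯 U.A₀ U.ρ₁ U.τ :=
  dressedStabilityWith_of_bookingLeaves U 𝒯 fun p K =>
    bookingLeavesOfLeaves U (𝒯.T p K) (ρ p K) (c p K) (s₀ p K) (S p K) (hρ p K) (hc p K) (hLF p K) (hLC p K) (hLA p K)
      (hLB p K) (hLT p K) (hLR p K)

/-- **THE SEAM between END-F's constants and the bundle's**: once the S3 cell fixes `U.C = 4c_δ∕r` and `U.m = m`, END-F's ∕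
END-F′'s conclusion IS leaf L-T with `ρ i = ψ·α i`. [folklore] -/
theorem leafT_of_transport {cδ r m ψ : ℝ} {α : ℕ → ℝ} {s₀ : Bk.Birth → ℕ → ℝ} {S : ℕ → Bk.Birth → Finset Bk.Birth}
    (hC : U.C = 4 * cδ / r) (hm : U.m = m)
    (h : T.TransportsFromVar (4 * cδ / r) (fun i => ψ * α i) (budgetGate T s₀ m S (4 * cδ / r) (fun i => ψ * α i))) :
    LeafT U T (fun i => ψ * α i) s₀ S := by
  unfold LeafT
  rw [hC, hm]
  exact h

end Faces

/-! ## §3 END-F with its binders NAMED BY THE F-ids of the DAG (F-1 … F-9), BY NAME -/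

section FunctionLevel

open MeasureTheory Set Metric
open T4BirthChartTransport (GaugeInvariant BirthSlice RelGauge)
open T4BlockTransport (Fld NDir latMove latN)
open T4TrajectoryDensity

variable {B : T4TermFormat.Booking} {T : Trajectory B}
variable {R : Type*} [NormedRing R] [NormedAlgebra ℂ R] [MeasurableSpace R] {d : ℕ}
  {F : Type*} [NormedAddCommGroup F] [NormedSpace ℂ F] [CompleteSpace F]

/-- **END-F BY LEAF ID — «L-T ⇐ F-1 … F-9»** (= `DressedRoot.transportLeaf_of_centredExponent` BY NAME, binders renamed and
grouped by the F-ids of `DAG.md` §2, types VERBATIM): F-1 `hF1` the (w1) birth slice [WALL for D-terms]; F-2 `hF2`∕`hF2'` the H2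
step representation through `wOp` and class membership [context]; F-3 `hF3`∕`hF3'` the (w2-act) real base and action-exponent
slice with margin `s b k` [WALL — THE NUMBER]; F-4 `hF4` the centred perturbation slice paid from the dressed budget [STRUCTURAL —
discharged by row S2 `DressedTransportAssembled.transportLeaf_assembled`, which has NO such binder]; F-5 `hF5a`…`hF5f` window
non-emptiness ∕ chart radius ∕ nesting ∕ diameter [GEOMETRY — discharged by row S1 `DressedWindowSchedule.h*_of_schedule`]; F-6
`hF6`∕`hF6'` the (I4′) transverse defects `≤ w` and `≤ c_δψ^{k−k′}` [WALL — the rate ψ, caveat k3]; F-7 `hF7` the (w4) rate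
domination `e³(1+4θ∕ϱ) ≤ α` [ARITHMETIC — row S3]; F-8 `hF8` attainment [STRUCTURAL — row S8]; F-9 `hF9`∕`hF9'` gauge invariance and
the full-measure window [context]; positivity `hα hr hw`.  Conclusion VERBATIM END-F's = the type of `BookingLeaves.htr` with
`C = 4c_δ∕r`, `ρ i = ψ·α i`.  The proof is END-F applied to the binders in END-F's order, nothing else. [folklore] -/
theorem transport_of_Fleaves {Fn : B.Birth → ℕ → ℕ → Fld d R → F}
    {rel : B.Birth → ℕ → ℕ → Fld d R → Fld d R → Prop} {𝒦 : B.Birth → ℕ → ℕ → Set (Fld d R)}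
    {ref : B.Birth → ℕ → Fld d R → Fld d R} {base : B.Birth → ℕ → Fld d R → ℝ}
    {𝒜 𝒬 : B.Birth → ℕ → Fld d R → Fld d R → ℂ} {q : B.Birth → ℕ → Fld d R → ℂ}
    {μ : B.Birth → ℕ → Measure (Fld d R)} {z₀ : B.Birth → ℕ → Fld d R} {D : B.Birth → ℕ → Set (Fld d R)}
    {defect : B.Birth → ℕ → ℕ → ℝ} {cδ ψ w r m : ℝ} {s θ : B.Birth → ℕ → ℝ} {α : ℕ → ℝ}
    {ϱ : B.Birth → ℕ → ℕ → ℝ} {S : ℕ → B.Birth → Finset B.Birth}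
    (hα : ∀ i, 0 ≤ α i) (hr : 0 < r) (hw : 0 < w)
    -- F-1 (w1): analytic births on the lattice chart [WALL for D-terms — displayed]
    (hF1 : ∀ (b : B.Birth) (k' : ℕ), B.birthScale b ≤ k' → k' ≤ B.K →
      RanBelow (budgetGate T s m S (4 * cδ / r) (fun i => ψ * α i)) k' →
      BirthSlice (Fn b k' k') latMove latN (𝒦 b k' k') w r (T.gen b k'))
    -- F-2 (H2): the dressed step law through `wOp` and class membership [context]
    (hF2 : ∀ (b : B.Birth) (k' k : ℕ), B.birthScale b ≤ k' → k' ≤ k → k + 1 ≤ B.K →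
      RanBelow (budgetGate T s m S (4 * cδ / r) (fun i => ψ * α i)) (k + 1) →
      ∀ U, Fn b k' (k + 1) U =
        wOp (expWeight (base b k) (𝒜 b k + 𝒬 b k)) (μ b k) (z₀ b k) U (fun z => Fn b k' k (U + z)))
    (hF2' : ∀ (b : B.Birth) (k' k : ℕ), B.birthScale b ≤ k' → k' ≤ k → k + 1 ≤ B.K →
      RanBelow (budgetGate T s m S (4 * cδ / r) (fun i => ψ * α i)) (k + 1) →
      ∀ U, (fun z => Fn b k' k (U + z)) ∈ BddClass F (μ b k))
    -- F-3 (w2-act): real base + action-exponent slice with margin `s b k` [WALL — THE NUMBER — displayed]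
    (hF3 : ∀ (b : B.Birth) (k' k : ℕ), B.birthScale b ≤ k' → k' ≤ k → k + 1 ≤ B.K →
      RanBelow (budgetGate T s m S (4 * cδ / r) (fun i => ψ * α i)) (k + 1) →
      RealBaseAt (ref b k) (base b k) (𝒜 b k) (μ b k) (𝒦 b k' (k + 1)))
    (hF3' : ∀ (b : B.Birth) (k' k : ℕ), B.birthScale b ≤ k' → k' ≤ k → k + 1 ≤ B.K →
      RanBelow (budgetGate T s m S (4 * cδ / r) (fun i => ψ * α i)) (k + 1) →
      ExponentSliceAt (ref b k) (𝒜 b k) (μ b k) latMove latN (𝒦 b k' (k + 1)) w (ϱ b k' k) (s b k))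
    -- F-4: centred perturbation slice paid from the dressed budget [STRUCTURAL — discharged by row S2]
    (hF4 : ∀ (b : B.Birth) (k' k : ℕ), B.birthScale b ≤ k' → k' ≤ k → k + 1 ≤ B.K →
      RanBelow (budgetGate T s m S (4 * cδ / r) (fun i => ψ * α i)) (k + 1) →
      PertSlice (fun U z => 𝒬 b k U z - q b k U) (μ b k) latMove latN (𝒦 b k' (k + 1)) w (ϱ b k' k)
        (m * ∑ f ∈ S k b, T.envVar (4 * cδ / r) (fun i => ψ * α i) f k))
    -- F-5 (w3)⁺: window non-emptiness, chart radius, nesting, diameter [GEOMETRY — discharged by row S1]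
    (hF5a : ∀ b k, (D b k).Nonempty) (hF5b : ∀ b k' k, 0 < ϱ b k' k)
    (hF5c : ∀ (b : B.Birth) (k' k : ℕ), B.birthScale b ≤ k' → k' ≤ k → k + 1 ≤ B.K →
      ∀ z ∈ D b k, ∀ U ∈ 𝒦 b k' (k + 1), U + z ∈ 𝒦 b k' k)
    (hF5d : ∀ (b : B.Birth) (k' k : ℕ), B.birthScale b ≤ k' → k' ≤ k → k + 1 ≤ B.K →
      ∀ U₀ ∈ 𝒦 b k' (k + 1), ∀ p : NDir d R, latN p ≤ w → ∀ z' ∈ D b k, latMove U₀ p 1 + z' ∈ 𝒦 b k' k)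
    (hF5e : ∀ b k, ∀ z ∈ D b k, ∀ z' ∈ D b k, ∀ x ν, ‖z x ν - z' x ν‖ ≤ θ b k)
    (hF5f : ∀ b k, 0 < θ b k ∧ θ b k ≤ w)
    -- F-6 (I4′): transverse defects [WALL — the rate ψ = L⁻², caveat k3 — displayed]
    (hF6 : ∀ b k' k, defect b k' k ≤ w)
    (hF6' : ∀ (b : B.Birth) (k' k : ℕ), B.birthScale b ≤ k' → k' ≤ k → k ≤ B.K →
      defect b k' k ≤ cδ * ψ ^ (k - k'))
    -- F-7 (w4): rate domination [ARITHMETIC — row S3]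
    (hF7 : ∀ (b : B.Birth) (k' k : ℕ), B.birthScale b ≤ k' → k' ≤ k → k + 1 ≤ B.K →
      Real.exp 3 * (1 + 4 * θ b k / ϱ b k' k) ≤ α k)
    -- F-8: attainment of the booked Lipschitz datum [STRUCTURAL — row S8]
    (hF8 : ∀ (b : B.Birth) (k' k : ℕ), B.birthScale b ≤ k' → k' ≤ k → k ≤ B.K →
      RanBelow (budgetGate T s m S (4 * cδ / r) (fun i => ψ * α i)) k → ∀ ε > 0,
      ∃ U₀ ∈ 𝒦 b k' k, ∃ U₁ : Fld d R, RelGauge (rel b k' k) latMove latN U₀ U₁ (defect b k' k) ∧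
        T.lin b k' k ≤ ‖Fn b k' k U₁ - Fn b k' k U₀‖ + ε)
    -- F-9: gauge invariance and the full-measure window [context]
    (hF9 : ∀ b k' k, GaugeInvariant (rel b k' k) (Fn b k' k))
    (hF9' : ∀ b k, ∀ᵐ z ∂μ b k, z ∈ D b k) :
    T.TransportsFromVar (4 * cδ / r) (fun i => ψ * α i) (budgetGate T s m S (4 * cδ / r) (fun i => ψ * α i)) :=
  transportLeaf_of_centredExponent hα hr hw hF1 hF2 hF2' hF5a hF5b hF3 hF3' hF4 hF9' hF5c hF5d hF5e hF5f hF7 hF9 hF6 hF6'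
    hF8

end FunctionLevel

end Summit.QuantumFields.BalabanUV.T4Continuum.NE1p.LeafIndex

end
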